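import Literature.Geometry.Kaehler.ComplexTorusAnalyticCycleClass
import Literature.Geometry.Kaehler.HolomorphicChainPlanePeriods
import Literature.Geometry.Kaehler.HolomorphicChainAddProofs
import Literature.Geometry.Kaehler.ComplexTorusMapsLinear
import Mathlib.Algebra.Module.ZLattice.Basic
import HarnessLib

/-!
# The analytic cycle class of a complex sub-torus is its algebraic cycle class

Layer `Literature/Geometry/Kaehler`; lane `lit-hodgefound`, Layer A4, row A4-18 (b) stage (ii)
(`run/shared/lean/pub/lit-hodgefound/SKELETON.md` §P Q58, node N8b of
`lit-hodgefound-p07/Q58-STAGING.md`): the VALIDATION of the analytic cycle class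
`ComplexTorus.analyticCycleClass` (`ComplexTorusAnalyticCycleClass.lean`: the Poincaré dual of the
current of integration `ω ↦ ∫_Z ω` of a closed analytic `Z ⊆ X = E/Λ` of pure dimension `d` on the
invariant forms) on the sub-tori of stage (i). For a complex sub-torus datum
`Z : SubtorusFrame Φ (2d)` (row p08, `ComplexTorusSubtorusCycleClass.lean`: a positively oriented
saturated `ℤ`-basis `u` of `W ∩ Λ`, `W = Σ ℂ Φuⱼ` a complex `d`-plane) and `a ∈ E`, the translate
`Z.carrier a = π(a + W) ⊆ X` of the sub-torus `W/(W ∩ Λ)`: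

* `SubtorusFrame.mem_cover_preimage_carrier_iff` — its lift to the universal cover is
  `π⁻¹(π(a + W)) = a + W + Λ`; `SubtorusFrame.exists_pos_forall_latticeVec_mem` — UNIFORM LOCAL
  STRUCTURE: there is `r > 0` with `(Λ + W) ∩ B(0, r) ⊆ W` (the lattice `Λ` meets a bounded set in
  finitely many points and `W` is closed), so that near each of its points `a + W + Λ` is a single
  affine complex `d`-plane (`cover_preimage_carrier_inter_ball`);
* `SubtorusFrame.isRegularPointOfCodim_carrier`, `isClosed_carrier`, **`hasPureDim_carrier`** — the
  sub-torus is a (closed) analytic subset of `X` of pure dimension `d`, every point regular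
  (Lange (2023), §1.1 Exercise 1.1.6 (2)(a): the complex sub-tori of `X`; Chirka (1989), §2.3);
* `SubtorusFrame.carrier_analyticChain`, `approxTangentCone_analyticChain`,
  `frameVector_orientationFrame_analyticChain` — the chain `[π⁻¹ Z]` has carrier `a + W + Λ`,
  density `1` and orientation the canonical `2d`-vector of `W` (locality and translation invariance of
  approximate tangent cones, Federer 3.2.16, and `approxTangentCone_plane_eq`);
* `SubtorusFrame.fundamentalParallelotope`, `isAddFundamentalDomain_translate_fundamentalParallelotope`
  — the half-open period parallelotope `P = {Σ tⱼ Φuⱼ | t ∈ [0,1)^{2d}}` of `W ∩ Λ`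
  (Mathlib's `ZSpan.fundamentalDomain` of the real basis `Φu` of `W`) translated by `a` is a
  fundamental domain of `Λ` for `𝓗^{2d} ⌞ (a + W + Λ)`: it covers by `ZSpan.fract`, and its
  `Λ`-translates are disjoint BECAUSE THE FRAME IS SATURATED; its `𝓗^{2d}`-measure is that of the
  closed parallelotope (`ZSpan.fundamentalDomain_ae_parallelepiped`, isometry `W ↪ E`);
* **`SubtorusFrame.analyticCyclePeriod_carrier`** — hence `∫_{Z} ω = ω(Φu₀, …, Φu_{2d-1})`: the
  current of integration of the sub-torus on `H^{2d}(X, ℂ)` IS the algebraic period functional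
  `periodFunctional (Φu)` (the period over `a + P` equals the period of the plane chain `[W]` over the
  closed parallelotope, computed in `HolomorphicChainPlanePeriods.lean`);
  **`SubtorusFrame.analyticCycleClass_carrier`** — `[π(a + W)] = sign(e) · cycleFormOfFrame Φ e u`, row
  p08's algebraic cycle class of stage (i) (Voisin (2002), Cor. 11.15: `⟨[Z], α⟩_X = ∫_Z α_{|Z}`);
  **`SubtorusFrame.analyticCycleClass_carrier_mem_integralHodgeClasses`** — the analytic class of a
  sub-torus is an integral Hodge class, unconditionally (its periods on `H^{2d}(X, ℤ)` are the
  integers `η(Φu)`).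

Definitions with bodies (`frameBasis`, `fundamentalParallelotope`) and theorems; no named fact.

## References

* [VoisinHodgeI2002] C. Voisin, *Hodge Theory and Complex Algebraic Geometry I*, CUP (2002), §11.1.2
  Lemma 11.13, Cor. 11.15, §11.1.3 Prop. 11.20.
* [Lange2023AbelianVarietiesComplex] H. Lange, *Abelian Varieties over the Complex Numbers*, Springer
  (2023), §1.1.1 (period parallelotope), §1.1 Exercise 1.1.6 (2)(a) (complex sub-tori), §6.2.1 p. 302.
* [LangeBirkenhake1992] H. Lange, Ch. Birkenhake, *Complex Abelian Varieties* (1992), §1.1.1,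
  Exercise 1.1.6 (2)(a).
* [Chirka1989] E. M. Chirka, *Complex Analytic Sets*, Kluwer (1989), §2.3, §14.1 Cor., p. 174.
* [Federer1969] H. Federer, *Geometric Measure Theory*, Springer (1969), 3.2.16, 3.2.19.
-/

noncomputable section

open scoped Manifold ENNReal NNReal Pointwise
open MeasureTheory TopologicalSpace Set Function Complex Module Metric
open Literature.Geometry.GeometricMeasureTheory

namespace Literature.Geometry.Kaehler

-- Nested operator-norm instances on `Covector V m` / `Multivector V m`, as in `Currents.lean`.
set_option maxSynthPendingDepth 2

universe u

namespace ComplexTorus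

namespace SubtorusFrame

/-! ### The frame as a real basis of its complex span; the half-open period parallelotope -/

section Frame

variable {ι : Type*} {E : Type u} [NormedAddCommGroup E] [InnerProductSpace ℂ E]
  {Φ : (ι → ℝ) ≃L[ℝ] E} {d : ℕ}

/-- The lattice vectors of the frame lie in its complex span `W`. [cite: LangeBirkenhake1992, Exercise 1.1.6 (2)(a)] -/
theorem latticeVec_frame_mem_frameSpan (Z : SubtorusFrame Φ (2 * d)) (j : Fin (2 * d)) :
    latticeVec Φ (Z.frame j) ∈ frameSpan Φ Z.frame :=
  Submodule.subset_span ⟨j, rfl⟩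

/-- Membership in the real span of the frame is membership in its complex span.
[cite: LangeBirkenhake1992, Exercise 1.1.6 (2)(a)] -/
theorem mem_realSpan_iff (Z : SubtorusFrame Φ (2 * d)) {x : E} :
    x ∈ Z.realSpan ↔ x ∈ frameSpan Φ Z.frame := by
  rw [realSpan_eq_restrictScalars, Submodule.restrictScalars_mem]

/-- **The frame `Φu₀, …, Φu_{2d-1}` as a real basis of the complex `d`-plane `W = Σ ℂ Φuⱼ`**
(`2d = dim_ℝ W` linearly independent vectors). [cite: LangeBirkenhake1992, Exercise 1.1.6 (2)(a)] -/
def frameBasis (Z : SubtorusFrame Φ (2 * d)) : Basis (Fin (2 * d)) ℝ (frameSpan Φ Z.frame) :=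
  haveI : FiniteDimensional ℂ (frameSpan Φ Z.frame) :=
    FiniteDimensional.span_of_finite ℂ (Set.finite_range _)
  Basis.mk Z.posOriented.linearIndependent
    (Z.posOriented.linearIndependent.span_eq_top_of_card_eq_finrank'
      (by rw [Fintype.card_fin, finrank_real_of_complex, Z.finrank_frameSpan])).ge

/-- The vectors of `frameBasis` are the `Φuⱼ`. [cite: LangeBirkenhake1992, Exercise 1.1.6 (2)(a)] -/
@[simp] theorem coe_frameBasis_apply (Z : SubtorusFrame Φ (2 * d)) (j : Fin (2 * d)) :
    ((Z.frameBasis j : frameSpan Φ Z.frame) : E) = latticeVec Φ (Z.frame j) := by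
  rw [frameBasis, Basis.coe_mk, coe_frameInSpan, latticeTuple_apply]

/-- `val ∘ frameBasis = latticeTuple Φ u`. [cite: LangeBirkenhake1992, Exercise 1.1.6 (2)(a)] -/
theorem coe_comp_frameBasis (Z : SubtorusFrame Φ (2 * d)) :
    ((↑) : frameSpan Φ Z.frame → E) ∘ ⇑Z.frameBasis = latticeTuple Φ Z.frame := by
  funext j
  rw [Function.comp_apply, coe_frameBasis_apply, latticeTuple_apply]

/-- **Integral combinations of the frame are lattice vectors**: the `ℤ`-span of `Φu` inside `W` maps
into `Λ`. [cite: LangeBirkenhake1992, Exercise 1.1.6 (2)(a)] -/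
theorem coe_mem_periodLattice_of_mem_span (Z : SubtorusFrame Φ (2 * d)) {v : frameSpan Φ Z.frame}
    (hv : v ∈ Submodule.span ℤ (Set.range Z.frameBasis)) : (v : E) ∈ periodLattice Φ := by
  induction hv using Submodule.span_induction with
  | mem x hx =>
    obtain ⟨j, rfl⟩ := hx
    rw [coe_frameBasis_apply]
    exact latticeVec_mem_periodLattice Φ _
  | zero => exact (periodLattice Φ).zero_mem
  | add x y _ _ hx hy =>
    rw [Submodule.coe_add]
    exact (periodLattice Φ).add_mem hx hy
  | smul n x _ hx =>
    rw [Submodule.coe_smul_of_tower]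
    exact (periodLattice Φ).zsmul_mem hx n

/-- **Saturation, read in `E`**: a lattice vector lying in `W` is an integral combination of the
frame. [cite: LangeBirkenhake1992, Exercise 1.1.6 (2)(a)] -/
theorem exists_mem_span_coe_eq_of_latticeVec_mem (Z : SubtorusFrame Φ (2 * d)) {n : ι → ℤ}
    (hn : latticeVec Φ n ∈ frameSpan Φ Z.frame) :
    ∃ v ∈ Submodule.span ℤ (Set.range Z.frameBasis), (v : E) = latticeVec Φ n := by
  have hn' : latticeVec Φ n ∈ Submodule.span ℝ (Set.range (latticeTuple Φ Z.frame)) :=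
    (Z.mem_realSpan_iff).2 hn
  obtain ⟨c, hc⟩ := (Submodule.mem_span_range_iff_exists_fun ℤ).1 (Z.saturated n hn')
  refine ⟨∑ j, c j • Z.frameBasis j, Submodule.sum_mem _ fun j _ ↦
    Submodule.smul_mem _ _ (Submodule.subset_span ⟨j, rfl⟩), ?_⟩
  rw [← hc, ← latticeVecHom_apply, map_sum, Submodule.coe_sum]
  refine Finset.sum_congr rfl fun j _ ↦ ?_
  rw [Submodule.coe_smul_of_tower, coe_frameBasis_apply, map_zsmul, latticeVecHom_apply]

/-- The same for an element of the period lattice. [cite: LangeBirkenhake1992, Exercise 1.1.6 (2)(a)] -/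
theorem exists_mem_span_coe_eq_of_mem_periodLattice (Z : SubtorusFrame Φ (2 * d)) {x : E}
    (hx : x ∈ periodLattice Φ) (hxW : x ∈ frameSpan Φ Z.frame) :
    ∃ v ∈ Submodule.span ℤ (Set.range Z.frameBasis), (v : E) = x := by
  obtain ⟨n, rfl⟩ := (mem_periodLattice_iff Φ).1 hx
  exact Z.exists_mem_span_coe_eq_of_latticeVec_mem hxW

/-- **The half-open period parallelotope `P = {Σ tⱼ Φuⱼ | t ∈ [0,1)^{2d}} ⊆ W`** of the sublattice
`W ∩ Λ = Σ ℤ Φuⱼ` (Mathlib's `ZSpan.fundamentalDomain` of the real basis `Φu` of `W`, read in `E`):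
a set of representatives of the sub-torus `W/(W ∩ Λ)` (Lange (2023), §1.1.1: the period
parallelotope). [cite: Lange2023AbelianVarietiesComplex, §1.1.1] -/
def fundamentalParallelotope (Z : SubtorusFrame Φ (2 * d)) : Set E :=
  ((↑) : frameSpan Φ Z.frame → E) '' ZSpan.fundamentalDomain Z.frameBasis

/-- The half-open parallelotope lies in `W`. [cite: Lange2023AbelianVarietiesComplex, §1.1.1] -/
theorem fundamentalParallelotope_subset_frameSpan (Z : SubtorusFrame Φ (2 * d)) :
    Z.fundamentalParallelotope ⊆ (frameSpan Φ Z.frame : Set E) := by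
  rintro _ ⟨v, -, rfl⟩
  exact v.2

/-- The closed parallelotope of the frame is the image of the closed parallelotope of `frameBasis`.
[cite: Lange2023AbelianVarietiesComplex, §1.1.1] -/
theorem image_coe_parallelepiped_frameBasis (Z : SubtorusFrame Φ (2 * d)) :
    ((↑) : frameSpan Φ Z.frame → E) '' parallelepiped Z.frameBasis =
      parallelepiped (latticeTuple Φ Z.frame) := by
  have h := image_parallelepiped (((frameSpan Φ Z.frame).subtype).restrictScalars ℝ) Z.frameBasis
  simp only [LinearMap.coe_restrictScalars, Submodule.coe_subtype] at h
  rw [h, coe_comp_frameBasis]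

/-- The half-open parallelotope lies in the closed one `{Σ tⱼ Φuⱼ | t ∈ [0,1]^{2d}}`.
[cite: Lange2023AbelianVarietiesComplex, §1.1.1] -/
theorem fundamentalParallelotope_subset_parallelepiped (Z : SubtorusFrame Φ (2 * d)) :
    Z.fundamentalParallelotope ⊆ parallelepiped (latticeTuple Φ Z.frame) := by
  rw [← image_coe_parallelepiped_frameBasis]
  exact image_mono (ZSpan.fundamentalDomain_subset_parallelepiped Z.frameBasis)

/-- The closed parallelotope of the frame lies in `W`. [cite: Lange2023AbelianVarietiesComplex, §1.1.1] -/
theorem parallelepiped_subset_frameSpan (Z : SubtorusFrame Φ (2 * d)) :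
    parallelepiped (latticeTuple Φ Z.frame) ⊆ (frameSpan Φ Z.frame : Set E) := by
  rw [← image_coe_parallelepiped_frameBasis]
  rintro _ ⟨v, -, rfl⟩
  exact v.2

/-- The closed period parallelotope is compact. [cite: Lange2023AbelianVarietiesComplex, §1.1.1] -/
theorem isCompact_parallelepiped_latticeTuple (Z : SubtorusFrame Φ (2 * d)) :
    IsCompact (parallelepiped (latticeTuple Φ Z.frame)) :=
  isCompact_Icc.image (continuous_finsetSum _ fun i _ ↦ (continuous_apply i).smul continuous_const)

/-- **Every vector of `W` is a lattice vector plus a point of the half-open parallelotope**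
(`w = ⌊w⌋ + fract w` in the basis `Φu`). [cite: Lange2023AbelianVarietiesComplex, §1.1.1] -/
theorem exists_periodLattice_add_of_mem_frameSpan (Z : SubtorusFrame Φ (2 * d)) {w : E}
    (hw : w ∈ frameSpan Φ Z.frame) :
    ∃ l ∈ periodLattice Φ, l ∈ frameSpan Φ Z.frame ∧ ∃ q ∈ Z.fundamentalParallelotope, w = l + q := by
  set v : frameSpan Φ Z.frame := ⟨w, hw⟩ with hv
  refine ⟨((ZSpan.floor Z.frameBasis v : frameSpan Φ Z.frame) : E),
    Z.coe_mem_periodLattice_of_mem_span (ZSpan.floor Z.frameBasis v).2,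
    (ZSpan.floor Z.frameBasis v : frameSpan Φ Z.frame).2,
    ((ZSpan.fract Z.frameBasis v : frameSpan Φ Z.frame) : E),
    ⟨_, ZSpan.fract_mem_fundamentalDomain Z.frameBasis v, rfl⟩, ?_⟩
  rw [← Submodule.coe_add, ZSpan.fract_apply, add_sub_cancel]

/-- Points of the half-open period parallelotope are bounded by `Σⱼ ‖Φuⱼ‖`.
[cite: Lange2023AbelianVarietiesComplex, §1.1.1] -/
theorem norm_le_of_mem_fundamentalParallelotope (Z : SubtorusFrame Φ (2 * d)) {q : E}
    (hq : q ∈ Z.fundamentalParallelotope) : ‖q‖ ≤ ∑ j, ‖latticeVec Φ (Z.frame j)‖ := by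
  obtain ⟨v, hv, rfl⟩ := hq
  have h := ZSpan.norm_fract_le Z.frameBasis v
  rw [(ZSpan.fract_eq_self).2 hv] at h
  calc ‖(v : E)‖ = ‖v‖ := rfl
    _ ≤ ∑ j, ‖Z.frameBasis j‖ := h
    _ = ∑ j, ‖latticeVec Φ (Z.frame j)‖ :=
      Finset.sum_congr rfl fun j _ ↦ by rw [← coe_frameBasis_apply]; rfl

end Frame

/-! ### The lift `π⁻¹(π(a + W)) = a + W + Λ` and its uniform local structure -/

section Lift

variable {ι : Type*} {E : Type u} [NormedAddCommGroup E] [InnerProductSpace ℂ E]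
  {Φ : (ι → ℝ) ≃L[ℝ] E} {d : ℕ}

/-- **The lift of the sub-torus to the universal cover**: `π x ∈ π(a + W)` iff
`x = a + w + λ` with `w ∈ W`, `λ ∈ Λ` (the fibres of `π` are the `Λ`-cosets).
[cite: LangeBirkenhake1992, Lemma 1.1.3] -/
theorem mem_cover_preimage_carrier_iff (Z : SubtorusFrame Φ (2 * d)) (a : E) {x : E} :
    cover Φ x ∈ Z.carrier a ↔
      ∃ w ∈ frameSpan Φ Z.frame, ∃ n : ι → ℤ, x = a + w + latticeVec Φ n := by
  constructor
  · rintro ⟨w, hw, hwx⟩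
    obtain ⟨n, hn⟩ := (cover_eq_cover_iff Φ x (a + w)).1 hwx.symm
    exact ⟨w, (Z.mem_realSpan_iff).1 hw, n, hn⟩
  · rintro ⟨w, hw, n, rfl⟩
    exact ⟨w, (Z.mem_realSpan_iff).2 hw, ((cover_eq_cover_iff Φ _ (a + w)).2 ⟨n, rfl⟩).symm⟩

/-- Points `a + w`, `w ∈ W`, lie over the sub-torus. [cite: LangeBirkenhake1992, Lemma 1.1.3] -/
theorem cover_add_mem_carrier (Z : SubtorusFrame Φ (2 * d)) (a : E) {w : E}
    (hw : w ∈ frameSpan Φ Z.frame) : cover Φ (a + w) ∈ Z.carrier a :=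
  (Z.mem_cover_preimage_carrier_iff a).2 ⟨w, hw, 0, by
    rw [← latticeVecHom_apply, map_zero, add_zero]⟩

variable [Fintype ι]

/-- **A bounded region contains finitely many lattice vectors** (their coordinates are bounded
integers). [cite: LangeBirkenhake1992, §1.1.1] -/
theorem finite_setOf_norm_latticeVec_le (Φ : (ι → ℝ) ≃L[ℝ] E) (R : ℝ) :
    {n : ι → ℤ | ‖latticeVec Φ n‖ ≤ R}.Finite := by
  set B : ℝ := ‖(Φ.symm : E →L[ℝ] (ι → ℝ))‖ * R with hB
  refine (Set.Finite.pi (t := fun _ : ι ↦ Set.Icc ⌈-B⌉ ⌊B⌋) fun _ ↦ Set.finite_Icc _ _).subset ?_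
  intro n hn
  rw [Set.mem_setOf_eq] at hn
  rw [Set.mem_univ_pi]
  intro i
  have h1 : |(n i : ℝ)| ≤ B := by
    have h2 : |(n i : ℝ)| = ‖Φ.symm (latticeVec Φ n) i‖ := by
      rw [symm_latticeVec_apply, Real.norm_eq_abs]
    rw [h2]
    calc ‖Φ.symm (latticeVec Φ n) i‖ ≤ ‖Φ.symm (latticeVec Φ n)‖ := norm_le_pi_norm _ i
      _ ≤ ‖(Φ.symm : E →L[ℝ] (ι → ℝ))‖ * ‖latticeVec Φ n‖ :=
        (Φ.symm : E →L[ℝ] (ι → ℝ)).le_opNorm (latticeVec Φ n)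
      _ ≤ B := mul_le_mul_of_nonneg_left hn (norm_nonneg _)
  rw [abs_le] at h1
  exact ⟨Int.ceil_le.2 h1.1, Int.le_floor.2 h1.2⟩

/-- **Uniform local structure of `Λ + W`.** There is `r > 0` such that a vector `λ + w` (`λ ∈ Λ`,
`w ∈ W`) of norm `< r` has `λ ∈ W`: the lattice vectors of norm `≤ 1 + Σ ‖Φuⱼ‖` are finitely many,
and those outside the closed subspace `W` keep a positive distance from it (every `w ∈ W` being a
lattice vector of `W` plus a point of the period parallelotope). Consequently `Λ + W` is, near each
of its points, a single affine complex `d`-plane. [cite: LangeBirkenhake1992, §1.1.1] -/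
theorem exists_pos_forall_latticeVec_mem (Z : SubtorusFrame Φ (2 * d)) :
    ∃ r : ℝ, 0 < r ∧ ∀ (n : ι → ℤ) (w : E), w ∈ frameSpan Φ Z.frame →
      ‖latticeVec Φ n + w‖ < r → latticeVec Φ n ∈ frameSpan Φ Z.frame := by
  set W := frameSpan Φ Z.frame with hWdef
  haveI : FiniteDimensional ℂ W := FiniteDimensional.span_of_finite ℂ (Set.finite_range _)
  set R : ℝ := ∑ j, ‖latticeVec Φ (Z.frame j)‖ with hR
  -- the finitely many lattice points of norm `≤ 1 + R` outside `W`
  set S : Set (ι → ℤ) := {n | ‖latticeVec Φ n‖ ≤ 1 + R ∧ latticeVec Φ n ∉ W} with hS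
  have hSfin : S.Finite := (finite_setOf_norm_latticeVec_le Φ (1 + R)).subset fun n hn ↦ hn.1
  have hWc : IsClosed (W : Set E) := W.closed_of_finiteDimensional
  have hWne : (W : Set E).Nonempty := ⟨0, W.zero_mem⟩
  -- a positive lower bound `r ≤ 1` for the distances of these points to `W`
  obtain ⟨r, hr, hr1, hrS⟩ : ∃ r : ℝ, 0 < r ∧ r ≤ 1 ∧ ∀ n ∈ S, r ≤ infDist (latticeVec Φ n) W := by
    by_cases hSne : S.Nonempty
    · obtain ⟨n₀, hn₀, hmin⟩ := S.exists_min_image (fun n ↦ infDist (latticeVec Φ n) W) hSfin hSne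
      have hpos : 0 < infDist (latticeVec Φ n₀) (W : Set E) :=
        (hWc.notMem_iff_infDist_pos hWne).1 hn₀.2
      exact ⟨min 1 (infDist (latticeVec Φ n₀) W), lt_min one_pos hpos, min_le_left _ _,
        fun n hn ↦ (min_le_right _ _).trans (hmin n hn)⟩
    · exact ⟨1, one_pos, le_rfl, fun n hn ↦ (hSne ⟨n, hn⟩).elim⟩
  refine ⟨r, hr, fun n w hw hlt ↦ ?_⟩
  -- `w = l + q`, `l ∈ Λ ∩ W`, `q` in the period parallelotope
  obtain ⟨l, hlΛ, hlW, q, hq, rfl⟩ := Z.exists_periodLattice_add_of_mem_frameSpan hw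
  obtain ⟨m, rfl⟩ := (mem_periodLattice_iff Φ).1 hlΛ
  have hqW : q ∈ W := Z.fundamentalParallelotope_subset_frameSpan hq
  have hqR : ‖q‖ ≤ R := Z.norm_le_of_mem_fundamentalParallelotope hq
  -- the lattice vector `Φn + l`
  have hsum : latticeVec Φ n + latticeVec Φ m = latticeVec Φ (n + m) := by
    rw [← latticeVecHom_apply, ← latticeVecHom_apply, ← latticeVecHom_apply, map_add]
  have hnorm : ‖latticeVec Φ (n + m)‖ ≤ 1 + R := by
    have h1 : latticeVec Φ (n + m) = (latticeVec Φ n + (latticeVec Φ m + q)) - q := by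
      rw [← hsum]; abel
    rw [h1]
    calc ‖latticeVec Φ n + (latticeVec Φ m + q) - q‖
        ≤ ‖latticeVec Φ n + (latticeVec Φ m + q)‖ + ‖q‖ := norm_sub_le _ _
      _ ≤ 1 + R := add_le_add (hlt.le.trans hr1) hqR
  by_cases hmem : latticeVec Φ (n + m) ∈ W
  · have h2 : latticeVec Φ n = latticeVec Φ (n + m) - latticeVec Φ m := by rw [← hsum, add_sub_cancel_right]
    rw [h2]
    exact W.sub_mem hmem hlW
  · exfalso
    have h3 : r ≤ infDist (latticeVec Φ (n + m)) (W : Set E) := hrS _ ⟨hnorm, hmem⟩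
    have h4 : infDist (latticeVec Φ (n + m)) (W : Set E) ≤ dist (latticeVec Φ (n + m)) (-q) :=
      infDist_le_dist_of_mem (W.neg_mem hqW)
    have h5 : dist (latticeVec Φ (n + m)) (-q) = ‖latticeVec Φ n + (latticeVec Φ m + q)‖ := by
      rw [dist_eq_norm, sub_neg_eq_add, ← hsum, add_assoc]
    linarith [h5 ▸ h4]

/-- **Near each of its points the lift `a + W + Λ` of the sub-torus is ONE affine complex plane**:
with `r` as above, `π⁻¹(π(a + W)) ∩ B(x₀, r) = (x₀ + W) ∩ B(x₀, r)` for every `x₀` over the sub-torus.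
[cite: LangeBirkenhake1992, §1.1.1] -/
theorem exists_pos_forall_cover_preimage_carrier_inter_ball (Z : SubtorusFrame Φ (2 * d)) (a : E) :
    ∃ r : ℝ, 0 < r ∧ ∀ x₀ : E, cover Φ x₀ ∈ Z.carrier a →
      cover Φ ⁻¹' Z.carrier a ∩ ball x₀ r =
        (fun y ↦ -x₀ + y) ⁻¹' (frameSpan Φ Z.frame : Set E) ∩ ball x₀ r := by
  obtain ⟨r, hr, hrW⟩ := Z.exists_pos_forall_latticeVec_mem
  refine ⟨r, hr, fun x₀ hx₀ ↦ ?_⟩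
  obtain ⟨w₀, hw₀, n₀, rfl⟩ := (Z.mem_cover_preimage_carrier_iff a).1 hx₀
  ext x
  simp only [mem_inter_iff, mem_preimage, mem_ball, SetLike.mem_coe]
  constructor
  · rintro ⟨hx, hdist⟩
    obtain ⟨w, hw, n, rfl⟩ := (Z.mem_cover_preimage_carrier_iff a).1 hx
    refine ⟨?_, hdist⟩
    have hsub : latticeVec Φ n - latticeVec Φ n₀ = latticeVec Φ (n - n₀) := by
      rw [← latticeVecHom_apply, ← latticeVecHom_apply, ← latticeVecHom_apply, map_sub]
    have hkey : -(a + w₀ + latticeVec Φ n₀) + (a + w + latticeVec Φ n) =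
        latticeVec Φ (n - n₀) + (w - w₀) := by rw [← hsub]; abel
    have hlt : ‖latticeVec Φ (n - n₀) + (w - w₀)‖ < r := by
      rw [← hkey, neg_add_eq_sub, ← dist_eq_norm]; exact hdist
    have hmem := hrW (n - n₀) (w - w₀) ((frameSpan Φ Z.frame).sub_mem hw hw₀) hlt
    rw [hkey]
    exact (frameSpan Φ Z.frame).add_mem hmem ((frameSpan Φ Z.frame).sub_mem hw hw₀)
  · rintro ⟨hx, hdist⟩
    refine ⟨(Z.mem_cover_preimage_carrier_iff a).2 ⟨w₀ + (-(a + w₀ + latticeVec Φ n₀) + x),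
      (frameSpan Φ Z.frame).add_mem hw₀ hx, n₀, by abel⟩, hdist⟩

end Lift

end SubtorusFrame

end ComplexTorus

/-! ### Regular points: analytic-at, complex subspaces and their translates -/

section Regular

variable {E₁ : Type*} [NormedAddCommGroup E₁] [NormedSpace ℂ E₁] {H : Type*} [TopologicalSpace H]
  {I : ModelWithCorners ℂ E₁ H} {M : Type*} [TopologicalSpace M] [ChartedSpace H M]

/-- A regular point of some codimension is an analytic point (the submersive local equations are
local equations). [cite: Chirka1989, §2.3] -/
theorem IsRegularPointOfCodim.isAnalyticSetAt {Z : Set M} {q : ℕ} {x : M}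
    (h : IsRegularPointOfCodim I Z q x) : IsAnalyticSetAt I Z x := by
  obtain ⟨U, hU, hxU, f, hf, hZU, -⟩ := h
  exact ⟨U, hU, hxU, q, f, hf, hZU⟩

end Regular

section Subspace

variable {E : Type u} [NormedAddCommGroup E] [InnerProductSpace ℂ E] [FiniteDimensional ℂ E]

/-- **Every point of `E` is a regular point of codimension `dim E − dim W` of a complex subspace
`W ⊆ E`** (`W` is the kernel of a complex-linear surjection `E → ℂ^{dim E − dim W}`).
[cite: Chirka1989, §2.3] -/
theorem isRegularPointOfCodim_submodule (W : Submodule ℂ E) (y : E) :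
    IsRegularPointOfCodim 𝓘(ℂ, E) (W : Set E) (finrank ℂ E - finrank ℂ W) y := by
  obtain ⟨L, hL, hker⟩ := exists_linear_surjective_ker_eq W
  refine ⟨univ, isOpen_univ, mem_univ y, L, L.mdifferentiable.mdifferentiableOn, ?_, ?_⟩
  · ext v
    simp [hker]
  · rw [L.mfderiv_eq]
    exact hL

omit [FiniteDimensional ℂ E] in
/-- Translations of `E` are `MDifferentiable`. [folklore] -/
private theorem mdifferentiable_neg_add (c : E) : MDifferentiable 𝓘(ℂ, E) 𝓘(ℂ, E) fun x : E ↦ -c + x :=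
  ((contDiff_const.add contDiff_id).contMDiff (n := 1)).mdifferentiable one_ne_zero

omit [FiniteDimensional ℂ E] in
/-- … with surjective differential (the identity). [folklore] -/
private theorem surjective_mfderiv_neg_add (c y : E) :
    Function.Surjective (mfderiv 𝓘(ℂ, E) 𝓘(ℂ, E) (fun x : E ↦ -c + x) y) := by
  have h : HasMFDerivAt 𝓘(ℂ, E) 𝓘(ℂ, E) (fun x : E ↦ -c + x) y (ContinuousLinearMap.id ℂ E) :=
    ((hasFDerivAt_id y).const_add (-c)).hasMFDerivAt
  rw [h.mfderiv]
  exact fun v ↦ ⟨v, rfl⟩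

/-- **Every point of `E` is a regular point of codimension `dim E − dim W` of the affine plane
`c + W`.** [cite: Chirka1989, §2.3] -/
theorem isRegularPointOfCodim_translate_submodule (W : Submodule ℂ E) (c y : E) :
    IsRegularPointOfCodim 𝓘(ℂ, E) ((fun x : E ↦ -c + x) ⁻¹' (W : Set E)) (finrank ℂ E - finrank ℂ W) y :=
  (isRegularPointOfCodim_submodule W (-c + y)).preimage (mdifferentiable_neg_add c)
    (surjective_mfderiv_neg_add c y)

end Subspace

/-! ### The sub-torus is a closed analytic subset of pure dimension `d`, all its points regular -/

namespace ComplexTorus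

namespace SubtorusFrame

section Analytic

variable {ι : Type*} {E : Type u} [NormedAddCommGroup E] [InnerProductSpace ℂ E]
  {Φ : (ι → ℝ) ≃L[ℝ] E} {d : ℕ}

/-- **The sub-torus is the image of the closed period parallelotope**: `π(a + W) = π(a + P̄)`,
`P̄ = {Σ tⱼ Φuⱼ | t ∈ [0,1]^{2d}}` (every `w ∈ W` is a lattice vector of `W` plus a point of `P ⊆ P̄`).
[cite: Lange2023AbelianVarietiesComplex, §1.1.1] -/
theorem carrier_eq_image_parallelepiped (Z : SubtorusFrame Φ (2 * d)) (a : E) :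
    Z.carrier a = (fun w : E ↦ cover Φ (a + w)) '' parallelepiped (latticeTuple Φ Z.frame) := by
  apply Subset.antisymm
  · rintro _ ⟨w, hw, rfl⟩
    obtain ⟨l, hlΛ, -, q, hq, rfl⟩ :=
      Z.exists_periodLattice_add_of_mem_frameSpan ((Z.mem_realSpan_iff).1 hw)
    obtain ⟨m, rfl⟩ := (mem_periodLattice_iff Φ).1 hlΛ
    refine ⟨q, Z.fundamentalParallelotope_subset_parallelepiped hq, ?_⟩
    change cover Φ (a + q) = cover Φ (a + (latticeVec Φ m + q))
    rw [show a + (latticeVec Φ m + q) = a + q + latticeVec Φ m by abel, cover_add_latticeVec]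
  · rintro _ ⟨q, hq, rfl⟩
    exact ⟨q, (Z.mem_realSpan_iff).2 (Z.parallelepiped_subset_frameSpan hq), rfl⟩

/-- **The sub-torus is compact.** [cite: Lange2023AbelianVarietiesComplex, §1.1.1] -/
theorem isCompact_carrier (Z : SubtorusFrame Φ (2 * d)) (a : E) : IsCompact (Z.carrier a) := by
  rw [carrier_eq_image_parallelepiped]
  exact Z.isCompact_parallelepiped_latticeTuple.image
    ((continuous_cover Φ).comp (continuous_const.add continuous_id))

/-- **The sub-torus is closed.** [cite: Lange2023AbelianVarietiesComplex, §1.1.1] -/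
theorem isClosed_carrier (Z : SubtorusFrame Φ (2 * d)) (a : E) : IsClosed (Z.carrier a) :=
  (Z.isCompact_carrier a).isClosed

/-- The sub-torus contains `π a`. [cite: LangeBirkenhake1992, Exercise 1.1.6 (2)(a)] -/
theorem cover_mem_carrier (Z : SubtorusFrame Φ (2 * d)) (a : E) : cover Φ a ∈ Z.carrier a := by
  simpa using Z.cover_add_mem_carrier a (frameSpan Φ Z.frame).zero_mem

variable [Fintype ι] [FiniteDimensional ℂ E]

/-- **Every point of the lift `π⁻¹(π(a + W)) ⊆ E` is a regular point of codimension `dim E − d`**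
(locally it is the affine complex `d`-plane `x₀ + W`). [cite: Chirka1989, §2.3] -/
theorem isRegularPointOfCodim_cover_preimage_carrier (Z : SubtorusFrame Φ (2 * d)) (a : E) {x : E}
    (hx : cover Φ x ∈ Z.carrier a) :
    IsRegularPointOfCodim 𝓘(ℂ, E) (cover Φ ⁻¹' Z.carrier a) (finrank ℂ E - d) x := by
  obtain ⟨r, hr, hball⟩ := Z.exists_pos_forall_cover_preimage_carrier_inter_ball a
  have h := (isRegularPointOfCodim_translate_submodule (frameSpan Φ Z.frame) x x).congr_set isOpen_ball
    (mem_ball_self hr) (hball x hx).symm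
  rwa [Z.finrank_frameSpan] at h

/-- **Every point of the sub-torus `π(a + W) ⊆ X` is a regular point of codimension `dim E − d`**
(`π` is a local biholomorphism). [cite: Chirka1989, §2.3] -/
theorem isRegularPointOfCodim_carrier (Z : SubtorusFrame Φ (2 * d)) (a : E) {y : ComplexTorus Φ}
    (hy : y ∈ Z.carrier a) : IsRegularPointOfCodim 𝓘(ℂ, E) (Z.carrier a) (finrank ℂ E - d) y := by
  obtain ⟨x, rfl⟩ := cover_surjective Φ y
  exact (isRegularPointOfCodim_cover_preimage_iff Φ x).1 (Z.isRegularPointOfCodim_cover_preimage_carrier a hy)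

/-- The regular locus of the sub-torus is the whole sub-torus. [cite: Chirka1989, §2.3] -/
theorem regularLocus_carrier (Z : SubtorusFrame Φ (2 * d)) (a : E) :
    regularLocus 𝓘(ℂ, E) (Z.carrier a) = Z.carrier a :=
  Subset.antisymm (regularLocus_subset _) fun _ hy ↦ ⟨hy, _, Z.isRegularPointOfCodim_carrier a hy⟩

/-- **The sub-torus is an analytic subset of `X`.** [cite: Chirka1989, §2.3] -/
theorem isAnalyticSet_carrier (Z : SubtorusFrame Φ (2 * d)) (a : E) :
    IsAnalyticSet 𝓘(ℂ, E) (Z.carrier a) :=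
  isAnalyticSet_iff_isClosed_and.2
    ⟨Z.isClosed_carrier a, fun _ hy ↦ (Z.isRegularPointOfCodim_carrier a hy).isAnalyticSetAt⟩

/-- **The sub-torus `π(a + W)` is an analytic subset of `X` of pure dimension `d`** (Lange (2023),
Exercise 1.1.6 (2)(a): the complex sub-tori of `X`; every point is regular of codimension
`dim X − d`). [cite: Lange2023AbelianVarietiesComplex, §1.1 Exercise 1.1.6 (2)(a)] -/
theorem hasPureDim_carrier (Z : SubtorusFrame Φ (2 * d)) (a : E) :
    HasPureDim 𝓘(ℂ, E) (Z.carrier a) d := by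
  have hd : d ≤ finrank ℂ E := by
    rw [← Z.finrank_frameSpan]; exact (frameSpan Φ Z.frame).finrank_le
  exact ⟨finrank ℂ E - d, by omega, Z.isAnalyticSet_carrier a, ⟨_, Z.cover_mem_carrier a⟩,
    fun y hy ↦ Z.isRegularPointOfCodim_carrier a (regularLocus_subset _ hy)⟩

end Analytic

/-! ### The chain `[π⁻¹ Z]`: carrier `a + W + Λ`, density `1`, tangent plane `W` -/

section Chain

variable {ι : Type*} [Fintype ι] {E : Type u} [NormedAddCommGroup E] [InnerProductSpace ℂ E]
  [FiniteDimensional ℂ E] [MeasurableSpace E] [BorelSpace E] {Φ : (ι → ℝ) ≃L[ℝ] E} {d : ℕ}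

omit [MeasurableSpace E] [BorelSpace E] in
/-- **The carrier of the chain `[π⁻¹ Z]` of the sub-torus is the whole lift `π⁻¹(π(a + W)) = a + W + Λ`**
(all its points are regular). [cite: Chirka1989, §14.1 Cor., p. 174] -/
theorem carrier_analyticChain (Z : SubtorusFrame Φ (2 * d)) (a : E) :
    (analyticChain Φ (Z.hasPureDim_carrier a)).carrier = cover Φ ⁻¹' Z.carrier a := by
  rw [analyticChain, HolomorphicChain.carrier_ofSet]
  ext x
  constructor
  · rintro ⟨y, hy, rfl⟩
    exact (mem_liftSet_iff Φ).1 (regularLocus_subset _ hy)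
  · intro hx
    refine ⟨⟨x, trivial⟩, ?_, rfl⟩
    rw [mem_regularLocus_liftSet_iff, regularLocus_carrier]
    exact hx

omit [MeasurableSpace E] [BorelSpace E] in
/-- The density of `[π⁻¹ Z]` is `1` on the lift. [cite: Chirka1989, §14.1 Cor., p. 174] -/
theorem density_analyticChain (Z : SubtorusFrame Φ (2 * d)) (a : E) {x : E}
    (hx : cover Φ x ∈ Z.carrier a) : (analyticChain Φ (Z.hasPureDim_carrier a)).density x = 1 := by
  have hx' : x ∈ (analyticChain Φ (Z.hasPureDim_carrier a)).carrier := by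
    rw [carrier_analyticChain]; exact hx
  exact HolomorphicChain.density_ofSet_of_mem_carrier _ hx'

/-- **The approximate tangent plane of `𝓗^{2d} ⌞ (a + W + Λ)` at each of its points is `W`**
(locality of approximate tangent cones, Federer 3.2.16, translation invariance, and
`Tan^{2d}(𝓗^{2d} ⌞ W, 0) = W`). [cite: Federer1969, 3.2.16] -/
theorem approxTangentCone_analyticChain (Z : SubtorusFrame Φ (2 * d)) (a : E) {x : E}
    (hx : cover Φ x ∈ Z.carrier a) :
    approxTangentCone (2 * d)
        ((μHE[2 * d] : Measure E).restrict (analyticChain Φ (Z.hasPureDim_carrier a)).carrier) x =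
      (frameSpan Φ Z.frame : Set E) := by
  letI : InnerProductSpace ℝ E := InnerProductSpace.complexToReal
  obtain ⟨r, hr, hball⟩ := Z.exists_pos_forall_cover_preimage_carrier_inter_ball a
  rw [carrier_analyticChain, approxTangentCone_restrict_congr_of_isOpen (μ := (μHE[2 * d] : Measure E))
    isOpen_ball (mem_ball_self hr) (hball x hx)]
  have hWm : MeasurableSet (frameSpan Φ Z.frame : Set E) :=
    (frameSpan Φ Z.frame).closed_of_finiteDimensional.measurableSet
  have h := approxTangentCone_restrict_preimage_add_smul (m := 2 * d) hWm (-x) x one_pos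
  simp only [one_smul, neg_add_cancel] at h
  rw [h]
  exact HolomorphicChain.approxTangentCone_plane_eq (frameSpan Φ Z.frame) Z.finrank_frameSpan
    (frameSpan Φ Z.frame).zero_mem

/-- **The orientation `2d`-vector of `[π⁻¹ Z]` is the canonical `2d`-vector `u₀ ∧ iu₀ ∧ ⋯` of `W`**
at every point of the lift, for any unitary basis `u` of `W`. [cite: Chirka1989, §14.1, p. 174] -/
theorem frameVector_orientationFrame_analyticChain (Z : SubtorusFrame Φ (2 * d)) (a : E)
    {u : Fin d → E} (hu : Orthonormal ℂ u)
    (hspan : ((Submodule.span ℝ (Set.range (complexFrame u)) : Submodule ℝ E) : Set E) =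
      (frameSpan Φ Z.frame : Set E))
    {x : E} (hx : cover Φ x ∈ Z.carrier a) :
    frameVector ((analyticChain Φ (Z.hasPureDim_carrier a)).orientationFrame x) =
      frameVector (complexFrame u) :=
  (analyticChain Φ (Z.hasPureDim_carrier a)).frameVector_orientationFrame hu
    (by rw [Z.approxTangentCone_analyticChain a hx]; exact hspan)

omit [FiniteDimensional ℂ E] [MeasurableSpace E] [BorelSpace E] in
/-- Two frames with the same `m`-vector give the same value to every complex-valued constant form.
[folklore] -/
private theorem apply_eq_of_frameVector_eq {m : ℕ} {ξ ξ' : Fin m → E}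
    (h : frameVector ξ = frameVector ξ') (ω : E [⋀^Fin m]→L[ℝ] ℂ) : ω ξ = ω ξ' := by
  have hre := congrArg (fun M : Multivector E m ↦ M (reCLM.compContinuousAlternatingMap ω)) h
  have him := congrArg (fun M : Multivector E m ↦ M (imCLM.compContinuousAlternatingMap ω)) h
  simp only [frameVector_apply, ContinuousLinearMap.compContinuousAlternatingMap_coe, Function.comp_apply,
    reCLM_apply, imCLM_apply] at hre him
  exact Complex.ext hre him

/-- **The integrand of `[π⁻¹ Z]` at a constant form is the constant `ω(u₀, iu₀, …)` on the lift.**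
[cite: Chirka1989, §14.1 Cor., p. 174] -/
theorem integrand_analyticChain (Z : SubtorusFrame Φ (2 * d)) (a : E) {u : Fin d → E}
    (hu : Orthonormal ℂ u)
    (hspan : ((Submodule.span ℝ (Set.range (complexFrame u)) : Submodule ℝ E) : Set E) =
      (frameSpan Φ Z.frame : Set E))
    {x : E} (hx : cover Φ x ∈ Z.carrier a) (ω : E [⋀^Fin (2 * d)]→L[ℝ] ℂ) :
    (((analyticChain Φ (Z.hasPureDim_carrier a)).density x : ℝ) : ℂ) *
        ω ((analyticChain Φ (Z.hasPureDim_carrier a)).orientationFrame x) = ω (complexFrame u) := by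
  rw [Z.density_analyticChain a hx, Int.cast_one, ofReal_one, one_mul]
  exact apply_eq_of_frameVector_eq (Z.frameVector_orientationFrame_analyticChain a hu hspan hx) ω

end Chain

/-! ### The adapted fundamental domain `a + P` and the period of the sub-torus -/

section Period

variable {ι : Type*} [Fintype ι] {E : Type u} [NormedAddCommGroup E] [InnerProductSpace ℂ E]
  [FiniteDimensional ℂ E] [MeasurableSpace E] [BorelSpace E] {Φ : (ι → ℝ) ≃L[ℝ] E} {d : ℕ}

omit [Fintype ι] in
/-- The half-open period parallelotope is a Borel set. [cite: Lange2023AbelianVarietiesComplex, §1.1.1] -/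
theorem measurableSet_fundamentalParallelotope (Z : SubtorusFrame Φ (2 * d)) :
    MeasurableSet Z.fundamentalParallelotope := by
  have hWm : MeasurableSet (frameSpan Φ Z.frame : Set E) :=
    (frameSpan Φ Z.frame).closed_of_finiteDimensional.measurableSet
  exact (MeasurableEmbedding.subtype_coe hWm).measurableSet_image.2
    (ZSpan.fundamentalDomain_measurableSet Z.frameBasis)

omit [Fintype ι] in
/-- … and so are its translates. [cite: Lange2023AbelianVarietiesComplex, §1.1.1] -/
theorem measurableSet_translate_fundamentalParallelotope (Z : SubtorusFrame Φ (2 * d)) (a : E) :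
    MeasurableSet ((fun x ↦ a + x) '' Z.fundamentalParallelotope) := by
  rw [image_add_left]
  exact Z.measurableSet_fundamentalParallelotope.preimage (measurable_const_add (-a))

omit [MeasurableSpace E] [BorelSpace E] in
/-- The translate `a + P` lies over the sub-torus. [cite: Lange2023AbelianVarietiesComplex, §1.1.1] -/
theorem translate_fundamentalParallelotope_subset_carrier (Z : SubtorusFrame Φ (2 * d)) (a : E) :
    (fun x ↦ a + x) '' Z.fundamentalParallelotope ⊆ (analyticChain Φ (Z.hasPureDim_carrier a)).carrier := by
  rw [carrier_analyticChain]
  rintro _ ⟨q, hq, rfl⟩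
  exact Z.cover_add_mem_carrier a (Z.fundamentalParallelotope_subset_frameSpan hq)

/-- **`a + P` is a fundamental domain of `Λ` for `𝓗^{2d} ⌞ (a + W + Λ)`**: every point `a + w + λ` of
the lift has the translate `a + fract(w)` in `a + P`, and two distinct translates of `a + P` are
DISJOINT — a lattice vector `λ - λ' ∈ W` is an integral combination of the frame (the frame is
SATURATED), and `P` contains one point of each class modulo `Σ ℤ Φuⱼ`.
[cite: Lange2023AbelianVarietiesComplex, §1.1.1] -/
theorem isAddFundamentalDomain_translate_fundamentalParallelotope (Z : SubtorusFrame Φ (2 * d)) (a : E) :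
    IsAddFundamentalDomain (periodLattice Φ) ((fun x ↦ a + x) '' Z.fundamentalParallelotope)
      ((μHE[2 * d] : Measure E).restrict (analyticChain Φ (Z.hasPureDim_carrier a)).carrier) where
  nullMeasurableSet := (Z.measurableSet_translate_fundamentalParallelotope a).nullMeasurableSet
  ae_covers := by
    have hSm : MeasurableSet (cover Φ ⁻¹' Z.carrier a) :=
      ((Z.isClosed_carrier a).preimage (continuous_cover Φ)).measurableSet
    rw [carrier_analyticChain]
    filter_upwards [ae_restrict_mem hSm] with x hx
    obtain ⟨w, hw, n, rfl⟩ := (Z.mem_cover_preimage_carrier_iff a).1 hx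
    obtain ⟨l, hlΛ, -, q, hq, rfl⟩ := Z.exists_periodLattice_add_of_mem_frameSpan hw
    refine ⟨⟨-(l + latticeVec Φ n), (periodLattice Φ).neg_mem
      ((periodLattice Φ).add_mem hlΛ (latticeVec_mem_periodLattice Φ n))⟩, ?_⟩
    rw [periodLattice_vadd]
    exact ⟨q, hq, by simp only; abel⟩
  aedisjoint := by
    intro g g' hne
    refine (Set.disjoint_left.2 ?_).aedisjoint
    rintro y ⟨z, ⟨q, hq, rfl⟩, rfl⟩ ⟨z', ⟨q', hq', rfl⟩, hzz'⟩
    -- `g' + (a + q') = g + (a + q)` with `q, q' ∈ P`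
    change (g' : E) + (a + q') = (g : E) + (a + q) at hzz'
    obtain ⟨v, hv, rfl⟩ := hq
    obtain ⟨v', hv', rfl⟩ := hq'
    have hdiff : (g : E) - g' = (v' : E) - v := by
      have h1 : (g' : E) + (a + v') - ((g : E) + (a + v)) = 0 := sub_eq_zero.2 hzz'
      have h2 : (g' : E) + (a + v') - ((g : E) + (a + v)) = ((v' : E) - v) - ((g : E) - g') := by abel
      rw [h2, sub_eq_zero] at h1
      exact h1.symm
    have hdiffW : (g : E) - g' ∈ frameSpan Φ Z.frame := by
      rw [hdiff]; exact (frameSpan Φ Z.frame).sub_mem v'.2 v.2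
    obtain ⟨t, ht, htg⟩ := Z.exists_mem_span_coe_eq_of_mem_periodLattice
      ((periodLattice Φ).sub_mem g.2 g'.2) hdiffW
    -- `v' = t + v` in `W`
    have hv't : v' = (⟨t, ht⟩ : Submodule.span ℤ (Set.range Z.frameBasis)) +ᵥ v := by
      apply Subtype.ext
      change (v' : E) = ((t + v : frameSpan Φ Z.frame) : E)
      rw [Submodule.coe_add, htg, hdiff, sub_add_cancel]
    have h0 : (0 : Submodule.span ℤ (Set.range Z.frameBasis)) = -ZSpan.floor Z.frameBasis v :=
      (ZSpan.vadd_mem_fundamentalDomain Z.frameBasis 0 v).1 (by rwa [zero_vadd])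
    have h1 : (⟨t, ht⟩ : Submodule.span ℤ (Set.range Z.frameBasis)) = -ZSpan.floor Z.frameBasis v :=
      (ZSpan.vadd_mem_fundamentalDomain Z.frameBasis ⟨t, ht⟩ v).1 (by rwa [← hv't])
    have ht0 : t = 0 := by
      have h2 := h1.trans h0.symm
      rw [Subtype.ext_iff] at h2
      exact h2
    apply hne
    apply Subtype.ext
    rw [← sub_eq_zero, ← htg, ht0, Submodule.coe_zero]

omit [Fintype ι] [FiniteDimensional ℂ E] [MeasurableSpace E] [BorelSpace E] in
/-- The translate `a + P̄` of the closed period parallelotope is compact.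
[cite: Lange2023AbelianVarietiesComplex, §1.1.1] -/
theorem isCompact_translate_parallelepiped (Z : SubtorusFrame Φ (2 * d)) (a : E) :
    IsCompact ((fun x ↦ a + x) '' parallelepiped (latticeTuple Φ Z.frame)) :=
  Z.isCompact_parallelepiped_latticeTuple.image (continuous_const.add continuous_id)

/-- The vector density of `[π⁻¹ Z]` is integrable on `a + P` (a window inside the compact `a + P̄`;
Lelong). [cite: Harvey1977, Lemma 1.3] -/
theorem integrableOn_translate_fundamentalParallelotope (Z : SubtorusFrame Φ (2 * d)) (a : E) :
    IntegrableOn (fun x ↦ ((analyticChain Φ (Z.hasPureDim_carrier a)).density x : ℝ) •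
        frameVector ((analyticChain Φ (Z.hasPureDim_carrier a)).orientationFrame x))
      ((fun x ↦ a + x) '' Z.fundamentalParallelotope)
      ((μHE[2 * d] : Measure E).restrict (analyticChain Φ (Z.hasPureDim_carrier a)).carrier) :=
  (analyticChain Φ (Z.hasPureDim_carrier a)).integrableOn_density_smul_frameVector_of_subset_isCompact
    (image_mono Z.fundamentalParallelotope_subset_parallelepiped) (Z.isCompact_translate_parallelepiped a)
    (fun _ _ ↦ trivial)

omit [Fintype ι] in
/-- **`𝓗^{2d}(a + P) = 𝓗^{2d}(P̄)`**: translation invariance, `𝓗^{2d} ⌞ W` is the Lebesgue measure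
of `W` (the inclusion is an isometry), and the half-open and the closed parallelotope of a basis
differ by a null set (Mathlib's `ZSpan.fundamentalDomain_ae_parallelepiped`). [cite: Federer1969, 3.2.3] -/
theorem measure_translate_fundamentalParallelotope (Z : SubtorusFrame Φ (2 * d)) (a : E) :
    (μHE[2 * d] : Measure E) ((fun x ↦ a + x) '' Z.fundamentalParallelotope) =
      (μHE[2 * d] : Measure E) (parallelepiped (latticeTuple Φ Z.frame)) := by
  letI iW : InnerProductSpace ℝ (frameSpan Φ Z.frame) := InnerProductSpace.complexToReal
  have hiso : Isometry ((↑) : frameSpan Φ Z.frame → E) := isometry_subtype_coe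
  have hW2 : finrank ℝ (frameSpan Φ Z.frame) = 2 * d := by
    rw [finrank_real_of_complex, Z.finrank_frameSpan]
  have hvol : (μHE[2 * d] : Measure (frameSpan Φ Z.frame)) = volume := by
    have h : (μHE[finrank ℝ (frameSpan Φ Z.frame)] : Measure (frameSpan Φ Z.frame)) = volume :=
      InnerProductSpace.euclideanHausdorffMeasure_eq_volume
    rwa [hW2] at h
  calc (μHE[2 * d] : Measure E) ((fun x ↦ a + x) '' Z.fundamentalParallelotope)
      = (μHE[2 * d] : Measure E) Z.fundamentalParallelotope := by
        rw [image_add_left, measure_preimage_add]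
    _ = (μHE[2 * d] : Measure (frameSpan Φ Z.frame)) (ZSpan.fundamentalDomain Z.frameBasis) :=
        hiso.euclideanHausdorffMeasure_image _
    _ = (μHE[2 * d] : Measure (frameSpan Φ Z.frame)) (parallelepiped Z.frameBasis) := by
        rw [hvol]
        exact measure_congr (ZSpan.fundamentalDomain_ae_parallelepiped Z.frameBasis volume)
    _ = (μHE[2 * d] : Measure E) (((↑) : frameSpan Φ Z.frame → E) '' parallelepiped Z.frameBasis) :=
        (hiso.euclideanHausdorffMeasure_image _).symm
    _ = (μHE[2 * d] : Measure E) (parallelepiped (latticeTuple Φ Z.frame)) := by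
        rw [image_coe_parallelepiped_frameBasis]

/-- **The period of `[π⁻¹ Z]` over `a + P` is the period of the plane chain `[W]` over the closed
parallelotope `P̄`**: both are `𝓗^{2d}(P̄) · ω(u₀, iu₀, …)` (the integrands are the same constant, the
windows have the same measure). [cite: Chirka1989, §14.1 Cor., p. 174] -/
theorem constPeriod_analyticChain_translate_fundamentalParallelotope (Z : SubtorusFrame Φ (2 * d)) (a : E) :
    (analyticChain Φ (Z.hasPureDim_carrier a)).constPeriod ((fun x ↦ a + x) '' Z.fundamentalParallelotope) =
      (HolomorphicChain.plane (frameSpan Φ Z.frame) Z.finrank_frameSpan).constPeriod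
        (parallelepiped (latticeTuple Φ Z.frame)) := by
  obtain ⟨u, hu, hspan⟩ := exists_orthonormal_span_complexFrame_eq (frameSpan Φ Z.frame) Z.finrank_frameSpan
  set T := analyticChain Φ (Z.hasPureDim_carrier a) with hT
  have hDm := Z.measurableSet_translate_fundamentalParallelotope a
  have hDsub := Z.translate_fundamentalParallelotope_subset_carrier a
  have hPc := Z.isCompact_parallelepiped_latticeTuple
  refine LinearMap.ext fun ω ↦ ?_
  rw [T.constPeriod_apply (Z.integrableOn_translate_fundamentalParallelotope a) ω,
    Measure.restrict_restrict hDm, inter_eq_left.2 hDsub,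
    HolomorphicChain.constPeriod_plane_apply (frameSpan Φ Z.frame) Z.finrank_frameSpan hu hspan
      hPc.isClosed.measurableSet subset_rfl hPc ω,
    inter_eq_left.2 Z.parallelepiped_subset_frameSpan]
  have hpt : ∀ x ∈ (fun x ↦ a + x) '' Z.fundamentalParallelotope,
      ((T.density x : ℝ) : ℂ) * ω (T.orientationFrame x) = ω (complexFrame u) := by
    intro x hx
    have hxS : cover Φ x ∈ Z.carrier a := by
      have h := hDsub hx
      rw [carrier_analyticChain] at h
      exact h
    exact Z.integrand_analyticChain a hu hspan hxS ω
  rw [setIntegral_congr_fun hDm hpt, setIntegral_const, measureReal_def, measureReal_def,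
    Z.measure_translate_fundamentalParallelotope a]

/-- **The current of integration of the sub-torus on the invariant forms is the algebraic period
functional**: `∫_{π(a + W)} ω = ω(Φu₀, …, Φu_{2d-1})` for every `ω ∈ H^{2d}(X, ℂ) = Alt^{2d}_ℝ(E; ℂ)` —
`analyticCyclePeriod Φ _ = periodFunctional (latticeTuple Φ u)` (Voisin (2002), Lemma 11.13 /
Cor. 11.15: `∫_X β ∧ [Z] = ∫_Z β_{|Z}`, the right-hand side being, for the flat sub-torus and an
invariant `β`, the value of `β` on the positively oriented fundamental parallelotope of `W ∩ Λ`).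
[cite: VoisinHodgeI2002, §11.1.2 Cor. 11.15] -/
theorem analyticCyclePeriod_carrier (Z : SubtorusFrame Φ (2 * d)) (a : E) :
    analyticCyclePeriod Φ (Z.hasPureDim_carrier a) = periodFunctional (latticeTuple Φ Z.frame) := by
  rw [analyticCyclePeriod_eq_constPeriod Φ (Z.hasPureDim_carrier a)
      (Z.isAddFundamentalDomain_translate_fundamentalParallelotope a)
      (Z.integrableOn_translate_fundamentalParallelotope a),
    constPeriod_analyticChain_translate_fundamentalParallelotope, constPeriod_plane_eq_periodFunctional]

/-- `∫_{π(a + W)} ω = ω(Φu₀, …, Φu_{2d-1})`. [cite: VoisinHodgeI2002, §11.1.2 Cor. 11.15] -/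
theorem analyticCyclePeriod_carrier_apply (Z : SubtorusFrame Φ (2 * d)) (a : E)
    (ω : E [⋀^Fin (2 * d)]→L[ℝ] ℂ) :
    analyticCyclePeriod Φ (Z.hasPureDim_carrier a) ω = ω (latticeTuple Φ Z.frame) := by
  rw [analyticCyclePeriod_carrier, periodFunctional_apply]

/-- **The volume of the sub-torus is the `𝓗^{2d}`-measure of its period parallelotope**, read through
the Kähler form: `(ω^d/d!)(Φu₀, …, Φu_{2d-1}) = 𝓗^{2d}(P̄)` — Wirtinger's EQUALITY for the
parallelotope of a frame spanning a complex `d`-plane. [cite: Chirka1989, §13.3 Corollary and §14.1] -/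
theorem kaehlerPow_latticeTuple_eq_measureReal_parallelepiped (Z : SubtorusFrame Φ (2 * d)) (a : E) :
    ((kaehlerPow d (latticeTuple Φ Z.frame) : ℝ) : ℂ) =
      (((μHE[2 * d] : Measure E).real
        (periodBox Φ 0 ∩ (analyticChain Φ (Z.hasPureDim_carrier a)).carrier) : ℝ) : ℂ) := by
  rw [← analyticCyclePeriod_kaehlerPow Φ (Z.hasPureDim_carrier a), analyticCyclePeriod_carrier_apply]
  rfl

variable [DecidableEq ι] {n k : ℕ} (e : Fin n ≃ ι)

/-- **The analytic cycle class of a sub-torus is its algebraic cycle class**: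
`[π(a + W)] = sign(e) · cycleFormOfFrame Φ e u` — the stage-(ii) recipe `[Z] := (∫_Z ·)^♭`, computed
through the current of integration of the closed analytic subvariety `π(a + W) ⊆ X`, reproduces row
p08's class of stage (i) (Voisin (2002), Cor. 11.15). [cite: VoisinHodgeI2002, §11.1.2 Cor. 11.15] -/
theorem analyticCycleClass_carrier (h : 2 * d + k = n) (Z : SubtorusFrame Φ (2 * d)) (a : E) :
    analyticCycleClass Φ e h (Z.hasPureDim_carrier a) =
      (orientationSign Φ ((finCongr h).trans e) : ℂ) • cycleFormOfFrame Φ ((finCongr h).trans e) Z.frame := by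
  rw [analyticCycleClass, analyticCyclePeriod_carrier, poincareDualForm_periodFunctional_latticeTuple]

/-- The same in terms of `SubtorusFrame.cycleForm`: `[π(a + W)] = sign(e) · Z.cycleForm`.
[cite: VoisinHodgeI2002, §11.1.2 Cor. 11.15] -/
theorem analyticCycleClass_carrier_eq_smul_cycleForm (h : 2 * d + k = n) (Z : SubtorusFrame Φ (2 * d))
    (a : E) :
    analyticCycleClass Φ e h (Z.hasPureDim_carrier a) =
      (orientationSign Φ ((finCongr h).trans e) : ℂ) • Z.cycleForm ((finCongr h).trans e) :=
  Z.analyticCycleClass_carrier e h a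

/-- **`⟨γ, [π(a + W)]⟩_e = γ(Φu₀, …, Φu_{2d-1})`.** [cite: VoisinHodgeI2002, §11.1.2 Cor. 11.15] -/
theorem poincarePairing_analyticCycleClass_carrier (h : 2 * d + k = n) (Z : SubtorusFrame Φ (2 * d))
    (a : E) (γ : E [⋀^Fin (2 * d)]→L[ℝ] ℂ) :
    poincarePairing Φ e h γ (analyticCycleClass Φ e h (Z.hasPureDim_carrier a)) = γ (latticeTuple Φ Z.frame) := by
  rw [poincarePairing_analyticCycleClass, analyticCyclePeriod_carrier_apply]

/-- **The analytic cycle class of a sub-torus of codimension `p` is an integral Hodge class**,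
`[π(a + W)] ∈ H^{2p}(X, ℤ) ∩ H^{p,p}` — unconditionally: its periods on `H^{2d}(X, ℤ)` are the
integers `η(Φu)` (Voisin (2002), Prop. 11.20; Lange (2023), §6.2.1 p. 302: the fundamental class of
a subvariety is integral). [cite: VoisinHodgeI2002, §11.1.3 Prop. 11.20] -/
theorem analyticCycleClass_carrier_mem_integralHodgeClasses {p : ℕ} (h : 2 * d + 2 * p = n)
    (Z : SubtorusFrame Φ (2 * d)) (a : E) :
    analyticCycleClass Φ e h (Z.hasPureDim_carrier a) ∈ integralHodgeClasses Φ p :=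
  analyticCycleClass_mem_integralHodgeClasses Φ e h (Z.hasPureDim_carrier a) fun η hη ↦ by
    rw [analyticCyclePeriod_carrier]
    exact periodFunctional_latticeTuple_mem_range_int Φ Z.frame hη

/-- … in particular a Hodge class. [cite: Lange2023AbelianVarietiesComplex, §6.2.1 Lemma 6.2.7] -/
theorem analyticCycleClass_carrier_mem_hodgeClasses {p : ℕ} (h : 2 * d + 2 * p = n)
    (Z : SubtorusFrame Φ (2 * d)) (a : E) :
    analyticCycleClass Φ e h (Z.hasPureDim_carrier a) ∈ hodgeClasses Φ p :=
  integralHodgeClasses_subset_hodgeClasses Φ p (Z.analyticCycleClass_carrier_mem_integralHodgeClasses e h a)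

end Period

end SubtorusFrame

end ComplexTorus

end Literature.Geometry.Kaehler

end
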